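import Summits.BirchSwinnertonDyer.Rank1Residual.GaloisImage.ThreeTorsionPairValuesSubgroup
import Literature.NumberTheory.EllipticCurves.Fisher2012.HesseFamilyThreeCongruenceFormula
import HarnessLib

/-!
# Fisher's direct Hesse `3`-congruence is SYMPLECTIC for the cube-root pairings
# (cell `b2b-bsdres`, team n1011, seat p02 gen 10 — row T-E3SYMP, optional file F5c; TOOL)

HONEST FRAMING (cell `b2b-bsdres`, run/shared/lean/b2b/bsd-rank1-residual/, verbatim in every
file): the goal of the cell is to DELETE the COMBINATION-SHAPED residual classes of the
Birch–Swinnerton-Dyer formula for ALL analytic-rank `≤ 1` elliptic curves over `ℚ` — "full BSD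
formula for every rank `≤ 1` curve in class `C`" assembled STRICTLY from published theorems — so
that the rank-`≤ 1` remainder becomes exactly the CONSTRUCTION-SHAPED classes, which are TYPED
(missing-input `Prop`s), NOT attempted. This is not "finishing BSD". Team n1011 (N10 / N11):
research route; no claim beyond the stated classes; labels UNCHANGED; nothing is booked. Theorems
only (no definition, no named fact).

## What this file proves

* `hesse3_pairValue_transport` — under Fisher's map `x ↦ (ax + b)/(3λ − μx)` from
  `E : y² = x³ − 27c₄x − 54c₆` onto the Hesse-pencil member `E_{λ,μ}`, the pair values of a basis of
  the `3`-torsion (file F1) are multiplied by `𝔇(λ,μ) = λ⁴ − 6c₄λ²μ² − 8c₆λμ³ − 3c₄²μ⁴` (pure algebra).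
* **`hessePencil3_symplectic`** — for Weil-type pairings `e` on `E[3]` and `e′` on `E_{λ,μ}[3]`
  normalised by the cube-root formula (N) (`e S T · B₁ = B₂` on every basis; the pairings of
  `exists_cubeRootWeilPairing`), the `Γ_ℚ`-equivariant isomorphism `f : E[3] ≃ E_{λ,μ}[3]` of
  Fisher's Theorem 13.2 (direct family; the tree's `threeCongruent_hessePencil3_formula`) is
  SYMPLECTIC FOR THESE PAIRINGS: `e′ (f S) (f T) = e S T` for all `S, T`.  This restores, in the
  cube-root currency, the clause "directly (= symplectically) `3`-congruent" of Fisher's theorem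
  that the tree's `thm132_threeCongruent_hessePencil` drops; no identification of the cube-root
  pairing with the divisor-theoretic Weil pairing is claimed (files F2b/F3a).

References (context): T. Fisher, Proc. LMS 104 (2012) Thm. 13.2, §8, Rem. 8.6; Silverman *AEC* III.8.
-/

noncomputable section

open scoped Classical

open WeierstrassCurve WeierstrassCurve.Affine.Point Literature.NumberTheory.EllipticCurves
  Literature.NumberTheory.EllipticCurves.Fisher2012

namespace Summit.BirchSwinnertonDyer.Rank1Residual.GaloisImage.CubeRootPairing

/-! ### §1. The transport identity -/

/-- **Pair values scale by `𝔇(λ,μ)` under Fisher's Hesse map.** For four numbers `x₁, x₂, x₃, x₄`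
with the elementary symmetric functions of the `3`-division abscissae of `E : y² = x³ − 27c₄x − 54c₆`
(`Σx = 0`, `Σxx = −54c₄`, `Σxxx = 216c₆`, `3∏x = −729c₄²`) and images
`X(x) = (ax + b)/(3λ − μx)` under Fisher's map onto the Hesse-pencil member `E_{λ,μ}`
(`a = 3(λ³ − 3c₄λμ² − 2c₆μ³)`, `b = −27μ(c₄λ² + 2c₆λμ + c₄²μ²)`), the pair value transforms as
`b₄(E_{λ,μ}) − 3(X₁X₂ + X₃X₄) = 𝔇(λ,μ)·(b₄(E) − 3(x₁x₂ + x₃x₄))` (`b₄(E) = −54c₄`,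
`b₄(E_{λ,μ}) = −54𝔠₄(λ,μ)`).  Proof: with `s = x₁+x₂`, `p = x₁x₂`, `p′ = x₃x₄` one has
`s² = p + p′ + 54c₄`, `s(p − p′) = −216c₆`, `pp′ = −243c₄²`; the two denominators multiply to
`81𝔇` and the numerator is `(3aλ + bμ)²(p + p′) + const` with `3aλ + bμ = 9𝔇`.  (Evidence first:
seat numerics on random `(c₄,c₆,λ,μ)` gave the ratio `𝔇` exactly.) [folklore] -/
theorem hesse3_pairValue_transport {F : Type*} [Field F] [CharZero F] (c₄ c₆ l m x₁ x₂ x₃ x₄ : F)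
    (h1 : x₁ + x₂ + x₃ + x₄ = 0)
    (h2 : x₁ * x₂ + x₁ * x₃ + x₁ * x₄ + x₂ * x₃ + x₂ * x₄ + x₃ * x₄ = -54 * c₄)
    (h3 : x₁ * x₂ * x₃ + x₁ * x₂ * x₄ + x₁ * x₃ * x₄ + x₂ * x₃ * x₄ = 216 * c₆)
    (h4 : 3 * (x₁ * x₂ * x₃ * x₄) = -729 * c₄ ^ 2)
    (hN₁ : -m * x₁ + 3 * l ≠ 0) (hN₂ : -m * x₂ + 3 * l ≠ 0) (hN₃ : -m * x₃ + 3 * l ≠ 0)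
    (hN₄ : -m * x₄ + 3 * l ≠ 0) :
    -54 * (c₄ * l ^ 4 + 4 * c₆ * l ^ 3 * m + 6 * c₄ ^ 2 * l ^ 2 * m ^ 2 + 4 * c₄ * c₆ * l * m ^ 3 +
        (4 * c₆ ^ 2 - 3 * c₄ ^ 3) * m ^ 4) -
      3 * ((3 * (l ^ 3 - 3 * c₄ * l * m ^ 2 - 2 * c₆ * m ^ 3) * x₁ +
              -27 * m * (c₄ * l ^ 2 + 2 * c₆ * l * m + c₄ ^ 2 * m ^ 2)) / (-m * x₁ + 3 * l) *
            ((3 * (l ^ 3 - 3 * c₄ * l * m ^ 2 - 2 * c₆ * m ^ 3) * x₂ +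
              -27 * m * (c₄ * l ^ 2 + 2 * c₆ * l * m + c₄ ^ 2 * m ^ 2)) / (-m * x₂ + 3 * l)) +
          (3 * (l ^ 3 - 3 * c₄ * l * m ^ 2 - 2 * c₆ * m ^ 3) * x₃ +
              -27 * m * (c₄ * l ^ 2 + 2 * c₆ * l * m + c₄ ^ 2 * m ^ 2)) / (-m * x₃ + 3 * l) *
            ((3 * (l ^ 3 - 3 * c₄ * l * m ^ 2 - 2 * c₆ * m ^ 3) * x₄ +
              -27 * m * (c₄ * l ^ 2 + 2 * c₆ * l * m + c₄ ^ 2 * m ^ 2)) / (-m * x₄ + 3 * l))) =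
      (l ^ 4 - 6 * c₄ * l ^ 2 * m ^ 2 - 8 * c₆ * l * m ^ 3 - 3 * c₄ ^ 2 * m ^ 4) *
        (-54 * c₄ - 3 * (x₁ * x₂ + x₃ * x₄)) := by
  -- abbreviations
  set a : F := 3 * (l ^ 3 - 3 * c₄ * l * m ^ 2 - 2 * c₆ * m ^ 3) with ha
  set b : F := -27 * m * (c₄ * l ^ 2 + 2 * c₆ * l * m + c₄ ^ 2 * m ^ 2) with hb
  set s : F := x₁ + x₂ with hs
  set p : F := x₁ * x₂ with hp
  set p' : F := x₃ * x₄ with hp'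
  -- the three relations among `s, p, p'`
  have hsq : s ^ 2 = p + p' + 54 * c₄ := by
    rw [hs, hp, hp']; linear_combination (-1 : F) * h2 + (x₁ + x₂) * h1
  have hsp : s * (p - p') = -216 * c₆ := by
    rw [hs, hp, hp']; linear_combination (-1 : F) * h3 + (x₁ * x₂) * h1
  have hpp : p * p' = -243 * c₄ ^ 2 := by
    apply mul_left_cancel₀ (three_ne_zero' F)
    rw [hp, hp']; linear_combination h4
  have h34 : x₃ + x₄ = -s := by rw [hs]; linear_combination h1
  -- the two products of images
  have hX12 : (a * x₁ + b) / (-m * x₁ + 3 * l) * ((a * x₂ + b) / (-m * x₂ + 3 * l)) =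
      (a ^ 2 * p + a * b * s + b ^ 2) / (m ^ 2 * p - 3 * l * m * s + 9 * l ^ 2) := by
    rw [div_mul_div_comm]
    congr 1
    · rw [hs, hp]; ring
    · rw [hs, hp]; ring
  have hX34 : (a * x₃ + b) / (-m * x₃ + 3 * l) * ((a * x₄ + b) / (-m * x₄ + 3 * l)) =
      (a ^ 2 * p' - a * b * s + b ^ 2) / (m ^ 2 * p' + 3 * l * m * s + 9 * l ^ 2) := by
    rw [div_mul_div_comm]
    have e34 : x₄ = -s - x₃ := by linear_combination h34
    congr 1
    · rw [hp', e34]; ring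
    · rw [hp', e34]; ring
  have hN12 : m ^ 2 * p - 3 * l * m * s + 9 * l ^ 2 ≠ 0 := by
    have : m ^ 2 * p - 3 * l * m * s + 9 * l ^ 2 = (-m * x₁ + 3 * l) * (-m * x₂ + 3 * l) := by
      rw [hs, hp]; ring
    rw [this]; exact mul_ne_zero hN₁ hN₂
  have hN34 : m ^ 2 * p' + 3 * l * m * s + 9 * l ^ 2 ≠ 0 := by
    have : m ^ 2 * p' + 3 * l * m * s + 9 * l ^ 2 = (-m * x₃ + 3 * l) * (-m * x₄ + 3 * l) := by
      have e34 : x₄ = -s - x₃ := by linear_combination h34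
      rw [hp', e34]; ring
    rw [this]; exact mul_ne_zero hN₃ hN₄
  have hden := mul_ne_zero hN12 hN34
  rw [hX12, hX34, div_add_div _ _ hN12 hN34, ← mul_div_assoc, sub_div' hden, div_eq_iff hden,
    ha, hb]
  linear_combination
    ((-54 * (c₄ * l ^ 4 + 4 * c₆ * l ^ 3 * m + 6 * c₄ ^ 2 * l ^ 2 * m ^ 2 + 4 * c₄ * c₆ * l * m ^ 3 +
        (4 * c₆ ^ 2 - 3 * c₄ ^ 3) * m ^ 4) -
        (l ^ 4 - 6 * c₄ * l ^ 2 * m ^ 2 - 8 * c₆ * l * m ^ 3 - 3 * c₄ ^ 2 * m ^ 4) *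
          (-54 * c₄ - 3 * (p + p'))) * (-9 * l ^ 2 * m ^ 2) -
      18 * (3 * (l ^ 3 - 3 * c₄ * l * m ^ 2 - 2 * c₆ * m ^ 3)) *
        (-27 * m * (c₄ * l ^ 2 + 2 * c₆ * l * m + c₄ ^ 2 * m ^ 2)) * l * m) * hsq +
    ((-54 * (c₄ * l ^ 4 + 4 * c₆ * l ^ 3 * m + 6 * c₄ ^ 2 * l ^ 2 * m ^ 2 + 4 * c₄ * c₆ * l * m ^ 3 +
        (4 * c₆ ^ 2 - 3 * c₄ ^ 3) * m ^ 4) -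
        (l ^ 4 - 6 * c₄ * l ^ 2 * m ^ 2 - 8 * c₆ * l * m ^ 3 - 3 * c₄ ^ 2 * m ^ 4) *
          (-54 * c₄ - 3 * (p + p'))) * (3 * l * m ^ 3) -
      3 * (3 * (3 * (l ^ 3 - 3 * c₄ * l * m ^ 2 - 2 * c₆ * m ^ 3)) ^ 2 * l * m -
        (3 * (l ^ 3 - 3 * c₄ * l * m ^ 2 - 2 * c₆ * m ^ 3)) *
          (-27 * m * (c₄ * l ^ 2 + 2 * c₆ * l * m + c₄ ^ 2 * m ^ 2)) * m ^ 2)) * hsp +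
    ((-54 * (c₄ * l ^ 4 + 4 * c₆ * l ^ 3 * m + 6 * c₄ ^ 2 * l ^ 2 * m ^ 2 + 4 * c₄ * c₆ * l * m ^ 3 +
        (4 * c₆ ^ 2 - 3 * c₄ ^ 3) * m ^ 4) -
        (l ^ 4 - 6 * c₄ * l ^ 2 * m ^ 2 - 8 * c₆ * l * m ^ 3 - 3 * c₄ ^ 2 * m ^ 4) *
          (-54 * c₄ - 3 * (p + p'))) * m ^ 4 -
      6 * (3 * (l ^ 3 - 3 * c₄ * l * m ^ 2 - 2 * c₆ * m ^ 3)) ^ 2 * m ^ 2) * hpp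


/-! ### §2. Symplecticity of the direct Hesse congruence for the cube-root pairings -/

/-- **Fisher's direct Hesse `3`-congruence is symplectic for the cube-root pairings.** See the
module docstring. [cite: Fisher2012Hessian, Thm. 13.2 (n = 3)] -/
theorem hessePencil3_symplectic (c₄ c₆ l m : ℚ) [(c4c6Model c₄ c₆).IsElliptic]
    [(hessePencil3 c₄ c₆ l m).IsElliptic]
    {e : geomTorsion (c4c6Model c₄ c₆) 3 → geomTorsion (c4c6Model c₄ c₆) 3 → AlgebraicClosure ℚ}
    {e' : geomTorsion (hessePencil3 c₄ c₆ l m) 3 → geomTorsion (hessePencil3 c₄ c₆ l m) 3 →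
      AlgebraicClosure ℚ}
    (he3 : ∀ S T, e S T ^ 3 = 1) (hel : ∀ S₁ S₂ T, e (S₁ + S₂) T = e S₁ T * e S₂ T)
    (her : ∀ S T₁ T₂, e S (T₁ + T₂) = e S T₁ * e S T₂) (healt : ∀ T, e T T = 1)
    (he'3 : ∀ S T, e' S T ^ 3 = 1) (he'l : ∀ S₁ S₂ T, e' (S₁ + S₂) T = e' S₁ T * e' S₂ T)
    (he'r : ∀ S T₁ T₂, e' S (T₁ + T₂) = e' S T₁ * e' S T₂) (he'alt : ∀ T, e' T T = 1)
    (hN : ∀ S T : geomTorsion (c4c6Model c₄ c₆) 3, (S : geomPoints (c4c6Model c₄ c₆)) ≠ 0 → (T : geomPoints (c4c6Model c₄ c₆)) ≠ 0 →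
        ((S + T : geomTorsion (c4c6Model c₄ c₆) 3) : geomPoints (c4c6Model c₄ c₆)) ≠ 0 →
        ((S - T : geomTorsion (c4c6Model c₄ c₆) 3) : geomPoints (c4c6Model c₄ c₆)) ≠ 0 →
        e S T * (((c4c6Model c₄ c₆).baseChange (AlgebraicClosure ℚ)).b₄ -
          3 * (xOf (W := (c4c6Model c₄ c₆).baseChange (AlgebraicClosure ℚ)) ((S : geomTorsion (c4c6Model c₄ c₆) 3) : geomPoints (c4c6Model c₄ c₆)) *
              xOf (W := (c4c6Model c₄ c₆).baseChange (AlgebraicClosure ℚ)) ((T : geomTorsion (c4c6Model c₄ c₆) 3) : geomPoints (c4c6Model c₄ c₆)) +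
            xOf (W := (c4c6Model c₄ c₆).baseChange (AlgebraicClosure ℚ)) ((S + T : geomTorsion (c4c6Model c₄ c₆) 3) : geomPoints (c4c6Model c₄ c₆)) *
              xOf (W := (c4c6Model c₄ c₆).baseChange (AlgebraicClosure ℚ)) ((S - T : geomTorsion (c4c6Model c₄ c₆) 3) : geomPoints (c4c6Model c₄ c₆)))) =
          (((c4c6Model c₄ c₆).baseChange (AlgebraicClosure ℚ)).b₄ -
          3 * (xOf (W := (c4c6Model c₄ c₆).baseChange (AlgebraicClosure ℚ)) ((S : geomTorsion (c4c6Model c₄ c₆) 3) : geomPoints (c4c6Model c₄ c₆)) *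
              xOf (W := (c4c6Model c₄ c₆).baseChange (AlgebraicClosure ℚ)) ((S + T : geomTorsion (c4c6Model c₄ c₆) 3) : geomPoints (c4c6Model c₄ c₆)) +
            xOf (W := (c4c6Model c₄ c₆).baseChange (AlgebraicClosure ℚ)) ((T : geomTorsion (c4c6Model c₄ c₆) 3) : geomPoints (c4c6Model c₄ c₆)) *
              xOf (W := (c4c6Model c₄ c₆).baseChange (AlgebraicClosure ℚ)) ((S - T : geomTorsion (c4c6Model c₄ c₆) 3) : geomPoints (c4c6Model c₄ c₆)))))
    (hN' : ∀ S T : geomTorsion (hessePencil3 c₄ c₆ l m) 3, (S : geomPoints (hessePencil3 c₄ c₆ l m)) ≠ 0 → (T : geomPoints (hessePencil3 c₄ c₆ l m)) ≠ 0 →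
        ((S + T : geomTorsion (hessePencil3 c₄ c₆ l m) 3) : geomPoints (hessePencil3 c₄ c₆ l m)) ≠ 0 →
        ((S - T : geomTorsion (hessePencil3 c₄ c₆ l m) 3) : geomPoints (hessePencil3 c₄ c₆ l m)) ≠ 0 →
        e' S T * (((hessePencil3 c₄ c₆ l m).baseChange (AlgebraicClosure ℚ)).b₄ -
          3 * (xOf (W := (hessePencil3 c₄ c₆ l m).baseChange (AlgebraicClosure ℚ)) ((S : geomTorsion (hessePencil3 c₄ c₆ l m) 3) : geomPoints (hessePencil3 c₄ c₆ l m)) *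
              xOf (W := (hessePencil3 c₄ c₆ l m).baseChange (AlgebraicClosure ℚ)) ((T : geomTorsion (hessePencil3 c₄ c₆ l m) 3) : geomPoints (hessePencil3 c₄ c₆ l m)) +
            xOf (W := (hessePencil3 c₄ c₆ l m).baseChange (AlgebraicClosure ℚ)) ((S + T : geomTorsion (hessePencil3 c₄ c₆ l m) 3) : geomPoints (hessePencil3 c₄ c₆ l m)) *
              xOf (W := (hessePencil3 c₄ c₆ l m).baseChange (AlgebraicClosure ℚ)) ((S - T : geomTorsion (hessePencil3 c₄ c₆ l m) 3) : geomPoints (hessePencil3 c₄ c₆ l m)))) =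
          (((hessePencil3 c₄ c₆ l m).baseChange (AlgebraicClosure ℚ)).b₄ -
          3 * (xOf (W := (hessePencil3 c₄ c₆ l m).baseChange (AlgebraicClosure ℚ)) ((S : geomTorsion (hessePencil3 c₄ c₆ l m) 3) : geomPoints (hessePencil3 c₄ c₆ l m)) *
              xOf (W := (hessePencil3 c₄ c₆ l m).baseChange (AlgebraicClosure ℚ)) ((S + T : geomTorsion (hessePencil3 c₄ c₆ l m) 3) : geomPoints (hessePencil3 c₄ c₆ l m)) +
            xOf (W := (hessePencil3 c₄ c₆ l m).baseChange (AlgebraicClosure ℚ)) ((T : geomTorsion (hessePencil3 c₄ c₆ l m) 3) : geomPoints (hessePencil3 c₄ c₆ l m)) *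
              xOf (W := (hessePencil3 c₄ c₆ l m).baseChange (AlgebraicClosure ℚ)) ((S - T : geomTorsion (hessePencil3 c₄ c₆ l m) 3) : geomPoints (hessePencil3 c₄ c₆ l m))))) :
    ∃ f : geomTorsion (c4c6Model c₄ c₆) 3 ≃+ geomTorsion (hessePencil3 c₄ c₆ l m) 3,
      (∀ (σ : Field.absoluteGaloisGroup ℚ) (P : geomTorsion (c4c6Model c₄ c₆) 3),
        f (σ • P) = σ • f P) ∧ ∀ S T, e' (f S) (f T) = e S T := by
  letI : Algebra ℚ (AlgebraicClosure ℚ) := AlgebraicClosure.instAlgebra ℚ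
  obtain ⟨f, hf, hform⟩ := threeCongruent_hessePencil3_formula c₄ c₆ l m
  refine ⟨f, hf, ?_⟩
  -- a basis of `E[3]` and the exhaustion of `E[3]`
  obtain ⟨S₀, T₀, h₁, h₂, h₃, h₄⟩ := exists_geomTorsion_three_basis (c4c6Model c₄ c₆)
  have hex := geomTorsion_three_eq_of_basis (c4c6Model c₄ c₆) h₁ h₂ h₃ h₄
  -- non-vanishing of pairing values
  have hene : ∀ S T, e S T ≠ 0 := fun S T => ne_zero_of_pow_three_eq_one (he3 S T)
  have he'ne : ∀ S T, e' S T ≠ 0 := fun S T => ne_zero_of_pow_three_eq_one (he'3 S T)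
  -- it suffices to compare at the basis
  refine eq_of_eq_at_basis (f := fun S T => e' (f S) (f T)) (g := e)
    (fun S₁ S₂ T => by rw [map_add, he'l]) (fun S T₁ T₂ => by rw [map_add, he'r])
    (fun T => he'alt (f T)) (fun S T => he'ne _ _) hel her healt hene hex ?_
  -- membership / non-vanishing in the point currency
  have mem3 : ∀ P : geomTorsion (c4c6Model c₄ c₆) 3,
      (3 : ℤ) • (P : geomPoints (c4c6Model c₄ c₆)) = 0 := fun P => (Submodule.mem_torsionBy_iff _ _).mp P.2
  have ne0 : ∀ {P : geomTorsion (c4c6Model c₄ c₆) 3}, P ≠ 0 → (P : geomPoints (c4c6Model c₄ c₆)) ≠ 0 :=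
    fun hP h => hP (Subtype.ext h)
  have coords : ∀ (Q : ((c4c6Model c₄ c₆).baseChange (AlgebraicClosure ℚ)).toAffine.Point), Q ≠ 0 →
      ∃ x y hxy, Q = Affine.Point.some x y hxy := by
    intro Q hQ
    rcases Q with _ | ⟨x, y, hxy⟩
    · exact absurd Affine.Point.zero_def.symm hQ
    · exact ⟨x, y, hxy, rfl⟩
  obtain ⟨x₁, y₁, k₁, hS⟩ := coords (S₀ : geomPoints (c4c6Model c₄ c₆)) (ne0 h₁)
  obtain ⟨x₂, y₂, k₂, hT⟩ := coords (T₀ : geomPoints (c4c6Model c₄ c₆)) (ne0 h₂)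
  obtain ⟨x₃, y₃, k₃, hU⟩ := coords ((S₀ + T₀ : geomTorsion (c4c6Model c₄ c₆) 3) : geomPoints (c4c6Model c₄ c₆)) (ne0 h₃)
  obtain ⟨x₄, y₄, k₄, hW⟩ := coords ((S₀ - T₀ : geomTorsion (c4c6Model c₄ c₆) 3) : geomPoints (c4c6Model c₄ c₆)) (ne0 h₄)
  -- images under `f`
  obtain ⟨k₁', hfS⟩ := hform S₀ x₁ y₁ k₁ hS
  obtain ⟨k₂', hfT⟩ := hform T₀ x₂ y₂ k₂ hT
  obtain ⟨k₃', hfU⟩ := hform (S₀ + T₀) x₃ y₃ k₃ hU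
  obtain ⟨k₄', hfW⟩ := hform (S₀ - T₀) x₄ y₄ k₄ hW
  -- abscissae
  have ex₁ : xOf (W := ((c4c6Model c₄ c₆).baseChange (AlgebraicClosure ℚ))) (S₀ : geomPoints (c4c6Model c₄ c₆)) = x₁ := by rw [hS]; rfl
  have ex₂ : xOf (W := ((c4c6Model c₄ c₆).baseChange (AlgebraicClosure ℚ))) (T₀ : geomPoints (c4c6Model c₄ c₆)) = x₂ := by rw [hT]; rfl
  have ex₃ : xOf (W := ((c4c6Model c₄ c₆).baseChange (AlgebraicClosure ℚ))) ((S₀ + T₀ : geomTorsion (c4c6Model c₄ c₆) 3) : geomPoints (c4c6Model c₄ c₆)) = x₃ := by rw [hU]; rfl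
  have ex₄ : xOf (W := ((c4c6Model c₄ c₆).baseChange (AlgebraicClosure ℚ))) ((S₀ - T₀ : geomTorsion (c4c6Model c₄ c₆) 3) : geomPoints (c4c6Model c₄ c₆)) = x₄ := by rw [hW]; rfl
  have eX₁ : xOf (W := ((hessePencil3 c₄ c₆ l m).baseChange (AlgebraicClosure ℚ))) ((f S₀ : geomTorsion (hessePencil3 c₄ c₆ l m) 3) : geomPoints (hessePencil3 c₄ c₆ l m)) =
      ((algebraMap ℚ (AlgebraicClosure ℚ) (3 * (l ^ 3 - 3 * c₄ * l * m ^ 2 - 2 * c₆ * m ^ 3)) * x₁ +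
                algebraMap ℚ (AlgebraicClosure ℚ) (-27 * m * (c₄ * l ^ 2 + 2 * c₆ * l * m + c₄ ^ 2 * m ^ 2))) /
              (algebraMap ℚ (AlgebraicClosure ℚ) (-m) * x₁ + algebraMap ℚ (AlgebraicClosure ℚ) (3 * l))) := by rw [hfS]; rfl
  have eX₂ : xOf (W := ((hessePencil3 c₄ c₆ l m).baseChange (AlgebraicClosure ℚ))) ((f T₀ : geomTorsion (hessePencil3 c₄ c₆ l m) 3) : geomPoints (hessePencil3 c₄ c₆ l m)) =
      ((algebraMap ℚ (AlgebraicClosure ℚ) (3 * (l ^ 3 - 3 * c₄ * l * m ^ 2 - 2 * c₆ * m ^ 3)) * x₂ +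
                algebraMap ℚ (AlgebraicClosure ℚ) (-27 * m * (c₄ * l ^ 2 + 2 * c₆ * l * m + c₄ ^ 2 * m ^ 2))) /
              (algebraMap ℚ (AlgebraicClosure ℚ) (-m) * x₂ + algebraMap ℚ (AlgebraicClosure ℚ) (3 * l))) := by rw [hfT]; rfl
  have eX₃ : xOf (W := ((hessePencil3 c₄ c₆ l m).baseChange (AlgebraicClosure ℚ))) ((f S₀ + f T₀ : geomTorsion (hessePencil3 c₄ c₆ l m) 3) : geomPoints (hessePencil3 c₄ c₆ l m)) =
      ((algebraMap ℚ (AlgebraicClosure ℚ) (3 * (l ^ 3 - 3 * c₄ * l * m ^ 2 - 2 * c₆ * m ^ 3)) * x₃ +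
                algebraMap ℚ (AlgebraicClosure ℚ) (-27 * m * (c₄ * l ^ 2 + 2 * c₆ * l * m + c₄ ^ 2 * m ^ 2))) /
              (algebraMap ℚ (AlgebraicClosure ℚ) (-m) * x₃ + algebraMap ℚ (AlgebraicClosure ℚ) (3 * l))) := by rw [← map_add, hfU]; rfl
  have eX₄ : xOf (W := ((hessePencil3 c₄ c₆ l m).baseChange (AlgebraicClosure ℚ))) ((f S₀ - f T₀ : geomTorsion (hessePencil3 c₄ c₆ l m) 3) : geomPoints (hessePencil3 c₄ c₆ l m)) =
      ((algebraMap ℚ (AlgebraicClosure ℚ) (3 * (l ^ 3 - 3 * c₄ * l * m ^ 2 - 2 * c₆ * m ^ 3)) * x₄ +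
                algebraMap ℚ (AlgebraicClosure ℚ) (-27 * m * (c₄ * l ^ 2 + 2 * c₆ * l * m + c₄ ^ 2 * m ^ 2))) /
              (algebraMap ℚ (AlgebraicClosure ℚ) (-m) * x₄ + algebraMap ℚ (AlgebraicClosure ℚ) (3 * l))) := by rw [← map_sub, hfW]; rfl
  -- pair-value facts on both sides
  obtain ⟨hB₁, hB₂, -, -, -⟩ := pairValue_facts (c4c6Model c₄ c₆) hN h₁ h₂ h₃ h₄
  obtain ⟨g₁, g₂, g₃, g₄⟩ := basis_map (hessePencil3 c₄ c₆ l m) (c4c6Model c₄ c₆) f h₁ h₂ h₃ h₄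
  obtain ⟨hB₁', hB₂', -, -, -⟩ := pairValue_facts (hessePencil3 c₄ c₆ l m) hN' g₁ g₂ g₃ g₄
  rw [ex₁, ex₂, ex₃, ex₄] at hB₁ hB₂
  rw [eX₁, eX₂, eX₃, eX₄] at hB₁' hB₂'
  -- the two models over `ℚ̄`
  have hVE : ((c4c6Model c₄ c₆).baseChange (AlgebraicClosure ℚ)) = ⟨0, 0, 0, -27 * algebraMap ℚ (AlgebraicClosure ℚ) c₄, -54 * algebraMap ℚ (AlgebraicClosure ℚ) c₆⟩ := by
    simp only [c4c6Model, WeierstrassCurve.baseChange, WeierstrassCurve.map]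
    ext <;> simp
  have hb4 : ((c4c6Model c₄ c₆).baseChange (AlgebraicClosure ℚ)).b₄ = -54 * algebraMap ℚ (AlgebraicClosure ℚ) c₄ := by
    rw [hVE, WeierstrassCurve.b₄]; ring
  have hb4Q : (hessePencil3 c₄ c₆ l m).b₄ = -54 * (c₄ * l ^ 4 + 4 * c₆ * l ^ 3 * m + 6 * c₄ ^ 2 * l ^ 2 * m ^ 2 +
      4 * c₄ * c₆ * l * m ^ 3 + (4 * c₆ ^ 2 - 3 * c₄ ^ 3) * m ^ 4) := by
    rw [hessePencil3_eq, WeierstrassCurve.b₄]; ring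
  have hb4' : ((hessePencil3 c₄ c₆ l m).baseChange (AlgebraicClosure ℚ)).b₄ = -54 * (algebraMap ℚ (AlgebraicClosure ℚ) c₄ * algebraMap ℚ (AlgebraicClosure ℚ) l ^ 4 + 4 * algebraMap ℚ (AlgebraicClosure ℚ) c₆ * algebraMap ℚ (AlgebraicClosure ℚ) l ^ 3 * algebraMap ℚ (AlgebraicClosure ℚ) m +
      6 * algebraMap ℚ (AlgebraicClosure ℚ) c₄ ^ 2 * algebraMap ℚ (AlgebraicClosure ℚ) l ^ 2 * algebraMap ℚ (AlgebraicClosure ℚ) m ^ 2 + 4 * algebraMap ℚ (AlgebraicClosure ℚ) c₄ * algebraMap ℚ (AlgebraicClosure ℚ) c₆ * algebraMap ℚ (AlgebraicClosure ℚ) l * algebraMap ℚ (AlgebraicClosure ℚ) m ^ 3 +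
      (4 * algebraMap ℚ (AlgebraicClosure ℚ) c₆ ^ 2 - 3 * algebraMap ℚ (AlgebraicClosure ℚ) c₄ ^ 3) * algebraMap ℚ (AlgebraicClosure ℚ) m ^ 4) := by
    rw [WeierstrassCurve.baseChange, WeierstrassCurve.map_b₄, hb4Q]
    simp only [map_add, map_sub, map_mul, map_pow, map_neg, map_ofNat]
  rw [hb4] at hB₁ hB₂
  rw [hb4'] at hB₁' hB₂'
  -- Vieta for the four abscissae
  obtain ⟨v1, v2, v3, v4⟩ := vieta_coe (c4c6Model c₄ c₆) h₁ h₂ h₃ h₄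
  rw [ex₁, ex₂, ex₃, ex₄] at v1 v2 v3 v4
  have hVb₂ : ((c4c6Model c₄ c₆).baseChange (AlgebraicClosure ℚ)).b₂ = 0 := by rw [hVE, WeierstrassCurve.b₂]; ring
  have hVb₆ : ((c4c6Model c₄ c₆).baseChange (AlgebraicClosure ℚ)).b₆ = -216 * algebraMap ℚ (AlgebraicClosure ℚ) c₆ := by rw [hVE, WeierstrassCurve.b₆]; ring
  have hVb₈ : ((c4c6Model c₄ c₆).baseChange (AlgebraicClosure ℚ)).b₈ = -729 * algebraMap ℚ (AlgebraicClosure ℚ) c₄ ^ 2 := by rw [hVE, WeierstrassCurve.b₈]; ring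
  rw [hVb₂] at v1
  rw [hb4] at v2
  rw [hVb₆] at v3
  rw [hVb₈] at v4
  have w1 : x₁ + x₂ + x₃ + x₄ = 0 := (mul_eq_zero.mp v1.symm).resolve_left (by norm_num)
  have w2 : x₁ * x₂ + x₁ * x₃ + x₁ * x₄ + x₂ * x₃ + x₂ * x₄ + x₃ * x₄ = -54 * algebraMap ℚ (AlgebraicClosure ℚ) c₄ := v2.symm
  have w3 : x₁ * x₂ * x₃ + x₁ * x₂ * x₄ + x₁ * x₃ * x₄ + x₂ * x₃ * x₄ = 216 * algebraMap ℚ (AlgebraicClosure ℚ) c₆ := by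
    linear_combination v3
  have w4 : 3 * (x₁ * x₂ * x₃ * x₄) = -729 * algebraMap ℚ (AlgebraicClosure ℚ) c₄ ^ 2 := v4.symm
  -- `𝔇 ≠ 0` and the denominators
  have hD : (l ^ 4 - 6 * c₄ * l ^ 2 * m ^ 2 - 8 * c₆ * l * m ^ 3 - 3 * c₄ ^ 2 * m ^ 4) ≠ 0 := by
    have h := (isElliptic_hessePencil3_iff c₄ c₆ l m).mp inferInstance
    rwa [eval_hesseD3] at h
  have hDb : (algebraMap ℚ (AlgebraicClosure ℚ) l ^ 4 - 6 * algebraMap ℚ (AlgebraicClosure ℚ) c₄ * algebraMap ℚ (AlgebraicClosure ℚ) l ^ 2 * algebraMap ℚ (AlgebraicClosure ℚ) m ^ 2 -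
      8 * algebraMap ℚ (AlgebraicClosure ℚ) c₆ * algebraMap ℚ (AlgebraicClosure ℚ) l * algebraMap ℚ (AlgebraicClosure ℚ) m ^ 3 - 3 * algebraMap ℚ (AlgebraicClosure ℚ) c₄ ^ 2 * algebraMap ℚ (AlgebraicClosure ℚ) m ^ 4) ≠ 0 := by
    have e : (algebraMap ℚ (AlgebraicClosure ℚ) l ^ 4 - 6 * algebraMap ℚ (AlgebraicClosure ℚ) c₄ * algebraMap ℚ (AlgebraicClosure ℚ) l ^ 2 * algebraMap ℚ (AlgebraicClosure ℚ) m ^ 2 -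
        8 * algebraMap ℚ (AlgebraicClosure ℚ) c₆ * algebraMap ℚ (AlgebraicClosure ℚ) l * algebraMap ℚ (AlgebraicClosure ℚ) m ^ 3 - 3 * algebraMap ℚ (AlgebraicClosure ℚ) c₄ ^ 2 * algebraMap ℚ (AlgebraicClosure ℚ) m ^ 4) =
        algebraMap ℚ (AlgebraicClosure ℚ) (l ^ 4 - 6 * c₄ * l ^ 2 * m ^ 2 - 8 * c₆ * l * m ^ 3 - 3 * c₄ ^ 2 * m ^ 4) := by
      simp only [map_sub, map_mul, map_pow, map_ofNat]
    rw [e]; exact (map_ne_zero _).mpr hD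
  have hroot : ∀ {P : geomTorsion (c4c6Model c₄ c₆) 3} {x : AlgebraicClosure ℚ}, P ≠ 0 →
      xOf (W := ((c4c6Model c₄ c₆).baseChange (AlgebraicClosure ℚ))) (P : geomPoints (c4c6Model c₄ c₆)) = x →
      ((⟨0, 0, 0, -27 * algebraMap ℚ (AlgebraicClosure ℚ) c₄, -54 * algebraMap ℚ (AlgebraicClosure ℚ) c₆⟩ : WeierstrassCurve (AlgebraicClosure ℚ))).Ψ₃.eval x
        = 0 := by
    intro P x hP hx
    have h := eval_Ψ₃_coe (c4c6Model c₄ c₆) hP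
    rwa [hx, hVE] at h
  have d₁ := hesse3_den_ne_zero (algebraMap ℚ (AlgebraicClosure ℚ) c₄) (algebraMap ℚ (AlgebraicClosure ℚ) c₆) (algebraMap ℚ (AlgebraicClosure ℚ) l) (algebraMap ℚ (AlgebraicClosure ℚ) m) hDb (hroot h₁ ex₁)
  have d₂ := hesse3_den_ne_zero (algebraMap ℚ (AlgebraicClosure ℚ) c₄) (algebraMap ℚ (AlgebraicClosure ℚ) c₆) (algebraMap ℚ (AlgebraicClosure ℚ) l) (algebraMap ℚ (AlgebraicClosure ℚ) m) hDb (hroot h₂ ex₂)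
  have d₃ := hesse3_den_ne_zero (algebraMap ℚ (AlgebraicClosure ℚ) c₄) (algebraMap ℚ (AlgebraicClosure ℚ) c₆) (algebraMap ℚ (AlgebraicClosure ℚ) l) (algebraMap ℚ (AlgebraicClosure ℚ) m) hDb (hroot h₃ ex₃)
  have d₄ := hesse3_den_ne_zero (algebraMap ℚ (AlgebraicClosure ℚ) c₄) (algebraMap ℚ (AlgebraicClosure ℚ) c₆) (algebraMap ℚ (AlgebraicClosure ℚ) l) (algebraMap ℚ (AlgebraicClosure ℚ) m) hDb (hroot h₄ ex₄)
  -- the transport identity for the two pairings of the four abscissae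
  have T1 := hesse3_pairValue_transport (algebraMap ℚ (AlgebraicClosure ℚ) c₄) (algebraMap ℚ (AlgebraicClosure ℚ) c₆) (algebraMap ℚ (AlgebraicClosure ℚ) l) (algebraMap ℚ (AlgebraicClosure ℚ) m) x₁ x₂ x₃ x₄
    w1 w2 w3 w4 d₁ d₂ d₃ d₄
  have T2 := hesse3_pairValue_transport (algebraMap ℚ (AlgebraicClosure ℚ) c₄) (algebraMap ℚ (AlgebraicClosure ℚ) c₆) (algebraMap ℚ (AlgebraicClosure ℚ) l) (algebraMap ℚ (AlgebraicClosure ℚ) m) x₁ x₃ x₂ x₄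
    (by linear_combination w1) (by linear_combination w2) (by linear_combination w3)
    (by linear_combination w4) d₁ d₃ d₂ d₄
  -- read the pairings off the pair values
  have he0 : e S₀ T₀ = _ / _ := (eq_div_iff hB₁).mpr hB₂.symm
  have he0' : e' (f S₀) (f T₀) = _ / _ := (eq_div_iff hB₁').mpr hB₂'.symm
  simp only [map_mul, map_sub, map_add, map_neg, map_pow, map_ofNat, neg_mul] at he0' hB₁' T1 T2 ⊢
  rw [he0', he0, T2, T1, mul_div_mul_left _ _ hDb]
  ring

end Summit.BirchSwinnertonDyer.Rank1Residual.GaloisImage.CubeRootPairing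

end
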